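import Summits.FinalStateConjecture.FinalStateConjecture.Theses.ZeroEnergyKerrOrBomb

/-!
# Crux-ideate sketches (ideator 2, round 1) for `ErgoregionBombModT`
(stmt-FinalStateConjecture-17838, route ZeroEnergyKerrOrBomb)

First-lemma SIGNATURES (statements only, `def … : Prop`) for the two idea cards
`killing-light-points` and `no-null-membranes-in-the-doc`; every constant is an existing
tree / Mathlib declaration. Nothing here is an item; nothing is proved.
-/

noncomputable section

namespace Summit.FinalStateConjecture.FinalStateConjecture.Cruxes.ErgoregionBombModT.Ideator2

open Literature.Geometry.Lorentzian
open scoped Manifold Topology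
open Set Bundle

set_option linter.dupNamespace false

/-! ## Card `killing-light-points` -/

/-- (L0, pure Lorentzian algebra, provable now from `LorentzianMetric.pos_of_orthogonal`)
**The stationary limit surface is nowhere spacelike**: at a point where `T ≠ 0` is null, any
vector `v` orthogonal to `T` — in particular the metric gradient of `λ = g(T,T)`, since `dλ(T) = 0`
and `dλ` annihilates `T Σ_e ∋ T` — is not timelike: `0 ≤ g(v, v)`. Hence `(∇λ)² ≥ 0` on `{λ = 0}`,
with equality exactly at the LIGHT POINTS (where `∇λ ∥ T`). -/
def ErgosurfaceConormalNotTimelike : Prop :=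
  ∀ (𝓑 : StationaryAFBlackHole.{0}), ∀ x : 𝓑.carrier, 𝓑.killing x ≠ 0 →
    𝓑.metric.val x (𝓑.killing x) (𝓑.killing x) = 0 →
    ∀ v : TangentSpace (𝓡 4) x, 𝓑.metric.val x v (𝓑.killing x) = 0 → 0 ≤ 𝓑.metric.val x v v

/-- (L1, the card's first lemma) **A light point inhabits the antecedent of `ErgoregionBombModT`.**
If `p ∈ doc` lies on the stationary limit surface (`g(T,T)(p) = 0`) and `∇_T T ∥ T` at `p`
(equivalently `∇λ ∥ T`, i.e. `p` is a light point: by Killing's equation `∇_T T = -½ ∇λ`), then the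
`T`-orbit through `p`, affinely reparametrised, is a MAXIMAL null geodesic with non-vanishing
velocity and zero `T`-energy which stays for its whole parameter domain inside
`stationaryOrbit T {p}` — verbatim the trapping clause of the crux with `S = {p}`. (The domain is a
half-line iff `κ ≠ 0`, `∇_T T = κ T`: Hájíček 1973 / Hawking–Ellis p. 331 "integral null geodesic
curves of `K` on the stationary limit surface … if the gradient of `f` is non-zero on these curves,
and if they are geodesically complete in the past, they will contain points where `K` is zero",
impossible in the d.o.c.) -/
def LightPointInhabitsAntecedent : Prop :=
  ∀ (𝓑 : StationaryAFBlackHole.{0}) [𝓑.metric.HasLeviCivita],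
    𝓑.metric.IsGloballyHyperbolic 𝓑.timeOrientation →
    ∀ p ∈ 𝓑.doc, 𝓑.killing p ≠ 0 → 𝓑.metric.val p (𝓑.killing p) (𝓑.killing p) = 0 →
    (∃ κ : ℝ, 𝓑.metric.leviCivita 𝓑.killing p (𝓑.killing p) = κ • 𝓑.killing p) →
    ∃ (γ : ℝ → 𝓑.carrier) (s : Set ℝ),
      IsMaximalGeodesicOn 𝓑.metric.toPseudoRiemannianMetric.leviCivita γ s ∧ s.Nonempty ∧
      (∀ t ∈ s, 𝓑.metric.val (γ t) (velocity (𝓡 4) γ t) (velocity (𝓡 4) γ t) = 0 ∧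
        velocity (𝓡 4) γ t ≠ 0 ∧
        𝓑.metric.val (γ t) (velocity (𝓡 4) γ t) (𝓑.killing (γ t)) = 0) ∧
      (∀ t ∈ s, γ t ∈ stationaryOrbit 𝓑.killing ({p} : Set 𝓑.carrier))

/-- (L2, GH escape lemma mod `T`, provable now from the landed non-imprisonment chain
`bernalSanchez_isStronglyCausal_of_isGloballyHyperbolic` + `IsStronglyCausal.exists_forall_notMem_of_isCompact`)
**Killing time is unbounded along every inextendible ray trapped modulo the flow**: with `t` any
function with `dt(T) = 1` on the d.o.c. (a Killing time), a maximal causal geodesic confined to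
`stationaryOrbit T S`, `S` compact `⊆ doc`, has `t ∘ γ` unbounded above AND below on its domain —
otherwise it is imprisoned in the compact set `φ_[a,b](S)`. So the species of a trapped zero-energy
ray is read off its affine domain: `s = ℝ` (complete), or a half-line / bounded interval
(incomplete at Killing time `±∞`: blueshift / redshift lines). -/
def KillingTimeUnboundedAlongTrappedRay : Prop :=
  ∀ (𝓑 : StationaryAFBlackHole.{0}) [𝓑.metric.HasLeviCivita],
    𝓑.metric.IsGloballyHyperbolic 𝓑.timeOrientation →
    ∀ (t : 𝓑.carrier → ℝ), Continuous t →
      (∀ x ∈ 𝓑.doc, MDifferentiableAt (𝓡 4) 𝓘(ℝ, ℝ) t x ∧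
        mfderiv (𝓡 4) 𝓘(ℝ, ℝ) t x (𝓑.killing x) = 1) →
    ∀ S : Set 𝓑.carrier, IsCompact S → S ⊆ 𝓑.doc →
    ∀ (γ : ℝ → 𝓑.carrier) (s : Set ℝ),
      IsMaximalGeodesicOn 𝓑.metric.toPseudoRiemannianMetric.leviCivita γ s → s.Nonempty →
      (∀ u ∈ s, 𝓑.metric.val (γ u) (velocity (𝓡 4) γ u) (velocity (𝓡 4) γ u) = 0 ∧
        velocity (𝓡 4) γ u ≠ 0) →
      (∀ u ∈ s, γ u ∈ stationaryOrbit 𝓑.killing S) →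
      ¬ BddAbove ((t ∘ γ) '' s) ∧ ¬ BddBelow ((t ∘ γ) '' s)

/-! ## Card `no-null-membranes-in-the-doc` -/

/-- (M1, the card's first lemma, pure causal theory, provable now) **No null membrane separates
a point of the d.o.c. from `M_ext`.** Let `f` be `C¹` with `M_ext ⊆ {f > 0}`, and suppose that at
every zero of `f` in the d.o.c. the differential of `f` is `g(L, ·)` for a NULL, consistently
future-directed vector `L` (so `{f = 0} ∩ doc` is a null hypersurface, a one-way door for causal
curves). Then `f ≥ 0` on the whole d.o.c.: a point with `f < 0` could not signal to `M_ext`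
(along a future timelike curve `f` strictly decreases through every zero). The time-dual
(`L` past-directed, using `doc ⊆ I⁺(M_ext)`) is the same statement for `τ.reverse`. In particular
a `T`-invariant null hypersurface (generators `⊥ T`, hence ruled by zero-energy null geodesics and
lying in the closed ergoregion) can neither enclose the horizon inside the ergoregion, nor bound a
pocket of the d.o.c., nor be a closed Killing prehorizon component. -/
def NoNullMembraneInDoc : Prop :=
  ∀ (𝓑 : StationaryAFBlackHole.{0}) (f : 𝓑.carrier → ℝ)
    (L : Π x : 𝓑.carrier, TangentSpace (𝓡 4) x),
    ContMDiff (𝓡 4) 𝓘(ℝ, ℝ) 1 f →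
    (∀ x ∈ 𝓑.Mext, 0 < f x) →
    (∀ x ∈ 𝓑.doc, f x = 0 →
      (∀ w : TangentSpace (𝓡 4) x, mfderiv (𝓡 4) 𝓘(ℝ, ℝ) f x w = 𝓑.metric.val x (L x) w) ∧
      𝓑.metric.val x (L x) (L x) = 0 ∧
      𝓑.metric.val x (L x) (𝓑.timeOrientation.vectorField x) < 0) →
    ∀ p ∈ 𝓑.doc, 0 ≤ f p

/-- (M2) **Zeros of the stationary field on a rotating horizon section** (Hawking–Ellis p. 331,
soft): `T` is tangent to `𝓗⁺`; it is null exactly where it is parallel to the collar generator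
`K`, and these points form whole generators. Typed consequence used by both cards: the stationary
limit surface meets the horizon exactly along the generators where `T ∥ K`. -/
def ErgosurfaceMeetsHorizonWhereTParallelK : Prop :=
  ∀ (𝓑 : StationaryAFBlackHole.{0}) (K : Π x : 𝓑.carrier, TangentSpace (𝓡 4) x),
    (∀ p ∈ 𝓑.horizon, K p ≠ 0 ∧ 𝓑.metric.val p (K p) (K p) = 0 ∧
      𝓑.metric.val p (𝓑.killing p) (K p) = 0) →
    ∀ p ∈ 𝓑.horizon, (𝓑.metric.val p (𝓑.killing p) (𝓑.killing p) = 0 ↔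
      ∃ c : ℝ, 𝓑.killing p = c • K p)

end Summit.FinalStateConjecture.FinalStateConjecture.Cruxes.ErgoregionBombModT.Ideator2

end
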